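import Mathlib.InformationTheory.KullbackLeibler.Basic
import Literature.MathematicalPhysics.KineticTheory.HardSphereEulerProofs
import Literature.Analysis.FluidPDE.HardSphereDynamicsProofs
import Summits.AtomisticToContinuum.HydrodynamicLimit.Theorems.CollisionIsometryCLTMacroClosureStubLedgerScaling
import HarnessLib

/-!
# Local Gibbs laws with bounded measurable profiles (support for `JaynesSqueeze.BlockGibbs`)

Support file (`--supports stmt-AtomisticToContinuum-13462`) for the typed waypoint
`Summit.AtomisticToContinuum.HydrodynamicLimit.Theses.JaynesSqueeze.BlockGibbs`: its REFERENCE law is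
the local Gibbs law `localGibbsLaw σ (ca ∘ idx m) (cu ∘ idx m) (cθ ∘ idx m) N Φ` with BLOCK-CONSTANT
— hence discontinuous, merely measurable and bounded — activity / velocity / temperature profiles,
whereas the tree's local Gibbs API (`HardSphereEulerProofs`: disintegration into positions and
conditionally Gaussian velocities, positivity of the partition function, normalisation) is stated
for CONTINUOUS profiles. This file re-proves that API under the hypotheses the block reference
actually satisfies — measurable profiles with `0 ≤ a ≤ A` (resp. `0 < a`), `0 < θ` — following the
continuous proofs line by line (continuity was only used for measurability and boundedness):

* `measurable_localGibbsProfile'`, `measurable_posWeight'`, `measurable_indicator_tensorPow'`;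
* `lintegral_gibbsWeight_mul'` — `∫ 𝟙_D f^{⊗n} G dz = ∫ dx 𝟙_{no overlap} ∏ a(xᵢ) ∫ G d(⊗ᵢ N(u(xᵢ), θ(xᵢ)))`;
* `canonicalPartition_eq_posPartition'`, `posPartition_pos'`, `localGibbsMeasure_univ'`,
  `lintegral_localGibbsMeasure'`;
* `isProbabilityMeasure_localGibbsLaw'` — the law is a probability measure for `σ ≤ 1/2`;
* the everywhere-positive Liouville density `Z⁻¹ ∏ₖ prof(zₖ)`: `canonicalPartition_localGibbs_pos'`,
  `gibbsDensity_pos'`, `measurable_gibbsDensity'`, `log_gibbsDensity'` (bookkeeping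
  `log (Z⁻¹ ∏ₖ prof(zₖ)) = (N+1)⟨emp z, log prof⟩ − log Z`).

No new definitions; everything is the tree's vocabulary (`localGibbsLaw`, `localGibbsMeasure`,
`canonicalPartition`, `posWeight`, `posPartition`, `velMeasure`, `zipConfig`, `empiricalMeasure`);
the hypothesis-free pieces (`localGibbsProfile_pos`, `logPair_eq_sum`,
`localGibbsLaw_eq_particleLaw_tensorPow`) are imported from `MacroClosureLine.StubLedger`.
The block index `idx m x = (⌊m · repr x i⌋₊)ᵢ` and the specialisation to the `BlockGibbs` reference
are in the companion file `JaynesSqueezeBlockGibbsBlockReference`.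
-/

noncomputable section

open MeasureTheory Filter Set Topology InformationTheory
open scoped ENNReal

namespace Summit.AtomisticToContinuum.HydrodynamicLimit.Theorems.BlockGibbsLine

open Literature.MathematicalPhysics.KineticTheory Literature.Analysis.FluidPDE
open Literature.Analysis.FunctionSpaces

variable {a₀ θ₀ : T3 → ℝ} {u₀ : T3 → V3}

/-! ## Measurability -/

/-- The local Gibbs profile `a(x) M_{1,u(x),θ(x)}(v)` is measurable for measurable profiles. [folklore] -/
theorem measurable_localGibbsProfile' (ha : Measurable a₀) (hθ : Measurable θ₀) (hu : Measurable u₀) :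
    Measurable (localGibbsProfile a₀ u₀ θ₀) := by
  unfold localGibbsProfile localMaxwellian
  refine (ha.comp measurable_fst).mul ((measurable_const.mul ?_).mul ?_)
  · exact ((measurable_const.mul (hθ.comp measurable_fst)).pow_const _)
  · refine Real.measurable_exp.comp ?_
    exact ((measurable_snd.sub (hu.comp measurable_fst)).norm.pow_const 2).neg.div
      (measurable_const.mul (hθ.comp measurable_fst))

/-- The position weight `𝟙_{no overlap}(x) ∏ᵢ a(xᵢ)` is measurable for a measurable activity. [folklore] -/
theorem measurable_posWeight' (ha : Measurable a₀) (ε : ℝ) (n : ℕ) : Measurable (posWeight a₀ ε n) :=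
  (Finset.measurable_prod _ fun i _ => ha.comp (measurable_pi_apply i)).indicator
    (measurableSet_posDomain ε n)

/-- The hard-sphere-restricted tensor power of a measurable local Gibbs profile is measurable. [folklore] -/
theorem measurable_indicator_tensorPow' (ha : Measurable a₀) (hθ : Measurable θ₀) (hu : Measurable u₀)
    (ε : ℝ) (n : ℕ) :
    Measurable ((hardSphereDomain (Torus.geometry (Fin 3)) n ε).indicator
      (tensorPow n (localGibbsProfile a₀ u₀ θ₀))) :=
  (measurable_tensorPow (measurable_localGibbsProfile' ha hθ hu) n).indicator
    (measurableSet_hardSphereDomain _ Torus.measurable_geometry_sepVec n ε)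

/-! ## Disintegration into positions and velocities -/

-- adapted from `Literature.MathematicalPhysics.KineticTheory.lintegral_gibbsWeight_mul` (continuous profiles)
/-- **Disintegration of the unnormalised local Gibbs weight** (measurable profiles, `a ≥ 0`, `θ > 0`):
for measurable `G ≥ 0`,
`∫ 𝟙_{D_ε} f^{⊗n} G dz = ∫ dx 𝟙_{no overlap}(x) ∏ a(xᵢ) ∫ G(x, v) ⊗ᵢ N(u(xᵢ), θ(xᵢ))(dv)`. [folklore] -/
theorem lintegral_gibbsWeight_mul' (ha : Measurable a₀) (hθ : Measurable θ₀) (hu : Measurable u₀)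
    (ha0 : ∀ x, 0 ≤ a₀ x) (hθ0 : ∀ x, 0 < θ₀ x) (ε : ℝ) (n : ℕ)
    {G : Config n (Fin 3) T3 → ℝ≥0∞} (hG : Measurable G) :
    ∫⁻ z, ENNReal.ofReal ((hardSphereDomain (Torus.geometry (Fin 3)) n ε).indicator
        (tensorPow n (localGibbsProfile a₀ u₀ θ₀)) z) * G z =
      ∫⁻ x, ENNReal.ofReal (posWeight a₀ ε n x) * ∫⁻ v, G (zipConfig (x, v)) ∂velMeasure u₀ θ₀ x := by
  set F : Config n (Fin 3) T3 → ℝ := (hardSphereDomain (Torus.geometry (Fin 3)) n ε).indicator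
    (tensorPow n (localGibbsProfile a₀ u₀ θ₀)) with hF
  have hFm : Measurable fun z => ENNReal.ofReal (F z) :=
    (measurable_indicator_tensorPow' ha hθ hu ε n).ennreal_ofReal
  set Mx : (Fin n → T3) → (Fin n) → V3 → ℝ≥0∞ :=
    fun x i w => ENNReal.ofReal (localMaxwellian 1 (θ₀ (x i)) (u₀ (x i)) w) with hMx
  have hMm : ∀ x i, Measurable (Mx x i) := fun x i =>
    (continuous_localMaxwellian 1 (θ₀ (x i)) (u₀ (x i))).measurable.ennreal_ofReal
  have hpt : ∀ (x : Fin n → T3) (v : Fin n → V3),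
      ENNReal.ofReal (F (zipConfig (x, v))) = ENNReal.ofReal (posWeight a₀ ε n x) * ∏ i, Mx x i (v i) := by
    intro x v
    rw [hF, indicator_tensorPow_zipConfig, ENNReal.ofReal_mul (posWeight_nonneg ha0 ε x),
      ENNReal.ofReal_prod_of_nonneg fun i _ => localMaxwellian_nonneg zero_le_one (hθ0 (x i)).le _ _]
  have hvel : ∀ x : Fin n → T3,
      (volume : Measure (Fin n → V3)).withDensity (fun v => ∏ i, Mx x i (v i)) = velMeasure u₀ θ₀ x := by
    intro x
    have hσf : ∀ i, SigmaFinite ((volume : Measure V3).withDensity (Mx x i)) := fun i => by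
      simp only [hMx]
      rw [withDensity_localMaxwellian_eq_gaussMeasure (hθ0 (x i))]
      infer_instance
    rw [volume_pi, ← pi_withDensity_eq (fun _ => volume) (hMm x) hσf, velMeasure]
    congr 1
    funext i
    exact withDensity_localMaxwellian_eq_gaussMeasure (hθ0 (x i)) (u₀ (x i))
  calc ∫⁻ z, ENNReal.ofReal (F z) * G z
      = ∫⁻ p, ENNReal.ofReal (F (zipConfig p)) * G (zipConfig p)
          ∂((volume : Measure (Fin n → T3)).prod volume) := by
        rw [← measurePreserving_zipConfig.lintegral_comp_emb
          (MeasurableEquiv.arrowProdEquivProdArrow T3 V3 (Fin n)).symm.measurableEmbedding]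
    _ = ∫⁻ x, ∫⁻ v, ENNReal.ofReal (F (zipConfig (x, v))) * G (zipConfig (x, v)) := by
        refine lintegral_prod _ ?_
        exact ((hFm.comp measurable_zipConfig).mul (hG.comp measurable_zipConfig)).aemeasurable
    _ = ∫⁻ x, ENNReal.ofReal (posWeight a₀ ε n x) * ∫⁻ v, (∏ i, Mx x i (v i)) * G (zipConfig (x, v)) := by
        refine lintegral_congr fun x => ?_
        have hg' : Measurable fun v : Fin n → V3 => G (zipConfig (x, v)) :=
          hG.comp (measurable_zipConfig.comp (measurable_const.prodMk measurable_id))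
        have hf' : Measurable fun v : Fin n → V3 => ∏ i, Mx x i (v i) :=
          Finset.measurable_prod _ fun i _ => (hMm x i).comp (measurable_pi_apply i)
        have hfg : Measurable fun v : Fin n → V3 => (∏ i, Mx x i (v i)) * G (zipConfig (x, v)) :=
          hf'.mul hg'
        simp_rw [hpt x, mul_assoc]
        rw [lintegral_const_mul _ hfg]
    _ = ∫⁻ x, ENNReal.ofReal (posWeight a₀ ε n x) * ∫⁻ v, G (zipConfig (x, v)) ∂velMeasure u₀ θ₀ x := by
        refine lintegral_congr fun x => ?_
        have hg' : Measurable fun v : Fin n → V3 => G (zipConfig (x, v)) :=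
          hG.comp (measurable_zipConfig.comp (measurable_const.prodMk measurable_id))
        have hf' : Measurable fun v : Fin n → V3 => ∏ i, Mx x i (v i) :=
          Finset.measurable_prod _ fun i _ => (hMm x i).comp (measurable_pi_apply i)
        congr 1
        rw [← hvel x, lintegral_withDensity_eq_lintegral_mul _ hf' hg']
        rfl

-- adapted from `Literature.MathematicalPhysics.KineticTheory.lintegral_localGibbsMeasure`
/-- **Disintegration of the local Gibbs measure** (measurable profiles, `a ≥ 0`, `θ > 0`): for
measurable `G ≥ 0`, `∫ G dP_N = ∫ dx Z⁻¹ 𝟙_{no overlap}(x) ∏ a(xᵢ) ∫ G(x, v) ⊗ᵢ N(u(xᵢ), θ(xᵢ))(dv)`.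
[folklore] -/
theorem lintegral_localGibbsMeasure' (ha : Measurable a₀) (hθ : Measurable θ₀) (hu : Measurable u₀)
    (ha0 : ∀ x, 0 ≤ a₀ x) (hθ0 : ∀ x, 0 < θ₀ x) (σ : ℝ) (N : ℕ)
    {G : Config (N + 1) (Fin 3) T3 → ℝ≥0∞} (hG : Measurable G) :
    ∫⁻ z, G z ∂localGibbsMeasure σ a₀ u₀ θ₀ N =
      ∫⁻ x, ENNReal.ofReal ((canonicalPartition (Torus.geometry (Fin 3)) (hsDiameter σ N) (N + 1)
          (localGibbsProfile a₀ u₀ θ₀))⁻¹ * posWeight a₀ (hsDiameter σ N) (N + 1) x) *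
        ∫⁻ v, G (zipConfig (x, v)) ∂velMeasure u₀ θ₀ x := by
  set ε := hsDiameter σ N with hε
  set Z := canonicalPartition (Torus.geometry (Fin 3)) ε (N + 1) (localGibbsProfile a₀ u₀ θ₀) with hZ
  have hZ0 : 0 ≤ Z⁻¹ :=
    inv_nonneg.2 (canonicalPartition_nonneg _ _ _ (localGibbsProfile_nonneg ha0 fun x => (hθ0 x).le))
  have hDm : Measurable fun z => ENNReal.ofReal
      (canonicalDensity (Torus.geometry (Fin 3)) ε (N + 1) (localGibbsProfile a₀ u₀ θ₀) z) :=
    (measurable_canonicalDensity ε (N + 1) (measurable_localGibbsProfile' ha hθ hu)).ennreal_ofReal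
  calc ∫⁻ z, G z ∂localGibbsMeasure σ a₀ u₀ θ₀ N
      = ∫⁻ z, ENNReal.ofReal (canonicalDensity (Torus.geometry (Fin 3)) ε (N + 1)
          (localGibbsProfile a₀ u₀ θ₀) z) * G z := by
        rw [localGibbsMeasure, lintegral_withDensity_eq_lintegral_mul _ hDm hG]
        rfl
    _ = ENNReal.ofReal Z⁻¹ * ∫⁻ z, ENNReal.ofReal ((hardSphereDomain (Torus.geometry (Fin 3))
          (N + 1) ε).indicator (tensorPow (N + 1) (localGibbsProfile a₀ u₀ θ₀)) z) * G z := by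
        rw [← lintegral_const_mul' _ _ ENNReal.ofReal_ne_top]
        refine lintegral_congr fun z => ?_
        rw [canonicalDensity, ENNReal.ofReal_mul hZ0, mul_assoc]
    _ = ENNReal.ofReal Z⁻¹ * ∫⁻ x, ENNReal.ofReal (posWeight a₀ ε (N + 1) x) *
          ∫⁻ v, G (zipConfig (x, v)) ∂velMeasure u₀ θ₀ x := by
        rw [lintegral_gibbsWeight_mul' ha hθ hu ha0 hθ0 ε (N + 1) hG]
    _ = _ := by
        rw [← lintegral_const_mul' _ _ ENNReal.ofReal_ne_top]
        refine lintegral_congr fun x => ?_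
        rw [ENNReal.ofReal_mul hZ0, mul_assoc]

/-! ## Normalisation -/

/-- The position weight of a measurable activity with `0 ≤ a ≤ A` is integrable. [folklore] -/
theorem integrable_posWeight' (ha : Measurable a₀) (ha0 : ∀ x, 0 ≤ a₀ x) {A : ℝ} (hA : ∀ x, a₀ x ≤ A)
    (ε : ℝ) (n : ℕ) : Integrable (posWeight a₀ ε n) := by
  refine (integrable_const (A ^ n)).mono' (measurable_posWeight' ha ε n).aestronglyMeasurable
    (Eventually.of_forall fun x => ?_)
  rw [Real.norm_eq_abs, abs_of_nonneg (posWeight_nonneg ha0 ε x)]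
  exact posWeight_le_pow ha0 hA ε x

/-- The configurational partition function as a lower Lebesgue integral (measurable bounded activity).
[folklore] -/
theorem ofReal_posPartition' (ha : Measurable a₀) (ha0 : ∀ x, 0 ≤ a₀ x) {A : ℝ} (hA : ∀ x, a₀ x ≤ A)
    (ε : ℝ) (n : ℕ) :
    ENNReal.ofReal (posPartition a₀ ε n) = ∫⁻ x, ENNReal.ofReal (posWeight a₀ ε n x) :=
  ofReal_integral_eq_lintegral_ofReal (integrable_posWeight' ha ha0 hA ε n)
    (Eventually.of_forall fun x => posWeight_nonneg ha0 ε x)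

/-- **The configurational partition function is positive** at `σ ≤ 1/2` for a measurable activity
with `0 < a ≤ A`: the non-overlap set has positive measure (`volume_setOf_lt_euclidDist_pos`). [folklore] -/
theorem posPartition_pos' (ha : Measurable a₀) (ha0 : ∀ x, 0 < a₀ x) {A : ℝ} (hA : ∀ x, a₀ x ≤ A)
    {σ : ℝ} (hσ2 : σ ≤ 1 / 2) (N : ℕ) : 0 < posPartition a₀ (hsDiameter σ N) (N + 1) := by
  have ha0' : ∀ x, 0 ≤ a₀ x := fun x => (ha0 x).le
  rw [posPartition, integral_pos_iff_support_of_nonneg (fun x => posWeight_nonneg ha0' _ x)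
    (integrable_posWeight' ha ha0' hA _ _)]
  refine lt_of_lt_of_le (volume_setOf_lt_euclidDist_pos hσ2 N) (measure_mono fun x hx => ?_)
  rw [Function.mem_support, posWeight,
    Set.indicator_of_mem (show x ∈ posDomain (hsDiameter σ N) (N + 1) from
      fun i j hij => (hx i j hij).le)]
  exact (Finset.prod_pos fun i _ => ha0 (x i)).ne'

/-- **The canonical partition function is the configurational one** (measurable profiles,
`a ≥ 0`, `θ > 0`): the Maxwellian velocity factors integrate to one. [folklore] -/
theorem canonicalPartition_eq_posPartition' (ha : Measurable a₀) (hθ : Measurable θ₀)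
    (hu : Measurable u₀) (ha0 : ∀ x, 0 ≤ a₀ x) (hθ0 : ∀ x, 0 < θ₀ x) (ε : ℝ) (n : ℕ) :
    canonicalPartition (Torus.geometry (Fin 3)) ε n (localGibbsProfile a₀ u₀ θ₀) = posPartition a₀ ε n := by
  have hF0 : ∀ z, 0 ≤ (hardSphereDomain (Torus.geometry (Fin 3)) n ε).indicator
      (tensorPow n (localGibbsProfile a₀ u₀ θ₀)) z := fun z =>
    Set.indicator_nonneg (fun w _ =>
      tensorPow_nonneg (localGibbsProfile_nonneg ha0 fun x => (hθ0 x).le) n w) z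
  rw [canonicalPartition, integral_eq_lintegral_of_nonneg_ae (Eventually.of_forall hF0)
      (measurable_indicator_tensorPow' ha hθ hu ε n).aestronglyMeasurable,
    posPartition, integral_eq_lintegral_of_nonneg_ae (Eventually.of_forall fun x => posWeight_nonneg ha0 ε x)
      (measurable_posWeight' ha ε n).aestronglyMeasurable]
  congr 1
  have h := lintegral_gibbsWeight_mul' ha hθ hu ha0 hθ0 ε n (G := fun _ => 1) measurable_const
  simpa only [mul_one, lintegral_const, measure_univ] using h

/-- The total mass of the local Gibbs measure is `Z_pos⁻¹ · Z_pos` (measurable profiles, `0 ≤ a ≤ A`,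
`θ > 0`). [folklore] -/
theorem localGibbsMeasure_univ' (ha : Measurable a₀) (hθ : Measurable θ₀) (hu : Measurable u₀)
    (ha0 : ∀ x, 0 ≤ a₀ x) {A : ℝ} (hA : ∀ x, a₀ x ≤ A) (hθ0 : ∀ x, 0 < θ₀ x) (σ : ℝ) (N : ℕ) :
    localGibbsMeasure σ a₀ u₀ θ₀ N univ =
      ENNReal.ofReal (posPartition a₀ (hsDiameter σ N) (N + 1))⁻¹ *
        ENNReal.ofReal (posPartition a₀ (hsDiameter σ N) (N + 1)) := by
  have h := lintegral_localGibbsMeasure' ha hθ hu ha0 hθ0 σ N (G := fun _ => 1) measurable_const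
  simp only [lintegral_const, measure_univ, mul_one, one_mul] at h
  rw [h, canonicalPartition_eq_posPartition' ha hθ hu ha0 hθ0]
  simp_rw [ENNReal.ofReal_mul (inv_nonneg.2 (posPartition_nonneg ha0 _ _))]
  rw [lintegral_const_mul' _ _ ENNReal.ofReal_ne_top, ← ofReal_posPartition' ha ha0 hA]

/-- **Local Gibbs measures with bounded measurable profiles are probability measures**: measurable
`a, θ, u` with `0 < a ≤ A`, `0 < θ`, reduced density `σ ≤ 1/2`, every particle number `N + 1`. [folklore] -/
theorem isProbabilityMeasure_localGibbsMeasure' (ha : Measurable a₀) (hθ : Measurable θ₀)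
    (hu : Measurable u₀) (ha0 : ∀ x, 0 < a₀ x) {A : ℝ} (hA : ∀ x, a₀ x ≤ A) (hθ0 : ∀ x, 0 < θ₀ x)
    {σ : ℝ} (hσ2 : σ ≤ 1 / 2) (N : ℕ) : IsProbabilityMeasure (localGibbsMeasure σ a₀ u₀ θ₀ N) := by
  have hP := posPartition_pos' ha ha0 hA hσ2 N
  refine ⟨?_⟩
  rw [localGibbsMeasure_univ' ha hθ hu (fun x => (ha0 x).le) hA hθ0 σ N,
    ← ENNReal.ofReal_mul (inv_nonneg.2 hP.le), inv_mul_cancel₀ hP.ne', ENNReal.ofReal_one]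

/-- **Local Gibbs laws with bounded measurable profiles are probability measures** (through any flow):
measurable `a, θ, u` with `0 < a ≤ A`, `0 < θ`, `σ ≤ 1/2`. This covers the block-constant reference of
`JaynesSqueeze.BlockGibbs`. [folklore] -/
theorem isProbabilityMeasure_localGibbsLaw' (ha : Measurable a₀) (hθ : Measurable θ₀)
    (hu : Measurable u₀) (ha0 : ∀ x, 0 < a₀ x) {A : ℝ} (hA : ∀ x, a₀ x ≤ A) (hθ0 : ∀ x, 0 < θ₀ x)
    {σ : ℝ} (hσ2 : σ ≤ 1 / 2) (N : ℕ)
    (Φ : HardSphereFlow (Torus.geometry (Fin 3)) (hsDiameter σ N) (N + 1)) :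
    IsProbabilityMeasure (localGibbsLaw σ a₀ u₀ θ₀ N Φ) := by
  rw [localGibbsLaw_eq]
  exact isProbabilityMeasure_localGibbsMeasure' ha hθ hu ha0 hA hθ0 hσ2 N

/-! ## The positive Liouville density and its logarithm -/

/-- The canonical partition function of the local Gibbs profile of a bounded measurable parameter
triple (`0 < a ≤ A`, `0 < θ`) is positive for `σ ≤ 1/2`. [folklore] -/
theorem canonicalPartition_localGibbs_pos' {σ : ℝ} (hσ2 : σ ≤ 1 / 2) (N : ℕ) {a θ : T3 → ℝ}
    {u : T3 → V3} (ha : Measurable a) (hθ : Measurable θ) (hu : Measurable u) (ha0 : ∀ x, 0 < a x)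
    {A : ℝ} (hA : ∀ x, a x ≤ A) (hθ0 : ∀ x, 0 < θ x) :
    0 < canonicalPartition (Torus.geometry (Fin 3)) (hsDiameter σ N) (N + 1) (localGibbsProfile a u θ) := by
  rw [canonicalPartition_eq_posPartition' ha hθ hu (fun x => (ha0 x).le) hθ0]
  exact posPartition_pos' ha ha0 hA hσ2 N

/-- The positive Gibbs density of a bounded measurable parameter triple is positive. [folklore] -/
theorem gibbsDensity_pos' {σ : ℝ} (hσ2 : σ ≤ 1 / 2) (N : ℕ) {a θ : T3 → ℝ} {u : T3 → V3}
    (ha : Measurable a) (hθ : Measurable θ) (hu : Measurable u) (ha0 : ∀ x, 0 < a x) {A : ℝ}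
    (hA : ∀ x, a x ≤ A) (hθ0 : ∀ x, 0 < θ x) (z : Config (N + 1) (Fin 3) T3) :
    0 < (canonicalPartition (Torus.geometry (Fin 3)) (hsDiameter σ N) (N + 1) (localGibbsProfile a u θ))⁻¹ *
      tensorPow (N + 1) (localGibbsProfile a u θ) z :=
  mul_pos (inv_pos.2 (canonicalPartition_localGibbs_pos' hσ2 N ha hθ hu ha0 hA hθ0))
    (Finset.prod_pos fun k _ => MacroClosureLine.StubLedger.localGibbsProfile_pos ha0 hθ0 (z k))

/-- The positive Gibbs density of a measurable parameter triple is measurable. [folklore] -/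
theorem measurable_gibbsDensity' (σ : ℝ) (N : ℕ) {a θ : T3 → ℝ} {u : T3 → V3}
    (ha : Measurable a) (hθ : Measurable θ) (hu : Measurable u) :
    Measurable fun z : Config (N + 1) (Fin 3) T3 =>
      (canonicalPartition (Torus.geometry (Fin 3)) (hsDiameter σ N) (N + 1) (localGibbsProfile a u θ))⁻¹ *
        tensorPow (N + 1) (localGibbsProfile a u θ) z :=
  measurable_const.mul (measurable_tensorPow (measurable_localGibbsProfile' ha hθ hu) _)

/-- **Bookkeeping of the positive Gibbs density** (bounded measurable profiles, `σ ≤ 1/2`):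
`log (Z⁻¹ ∏ₖ prof(zₖ)) = (N+1)·⟨emp z, log prof⟩ − log Z`. [folklore] -/
theorem log_gibbsDensity' {σ : ℝ} (hσ2 : σ ≤ 1 / 2) (N : ℕ) {a θ : T3 → ℝ} {u : T3 → V3}
    (ha : Measurable a) (hθ : Measurable θ) (hu : Measurable u) (ha0 : ∀ x, 0 < a x) {A : ℝ}
    (hA : ∀ x, a x ≤ A) (hθ0 : ∀ x, 0 < θ x) (z : Config (N + 1) (Fin 3) T3) :
    Real.log ((canonicalPartition (Torus.geometry (Fin 3)) (hsDiameter σ N) (N + 1) (localGibbsProfile a u θ))⁻¹ *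
        tensorPow (N + 1) (localGibbsProfile a u θ) z) =
      ((N : ℝ) + 1) * (∫ y, Real.log (localGibbsProfile a u θ y) ∂(empiricalMeasure z)) -
        Real.log (canonicalPartition (Torus.geometry (Fin 3)) (hsDiameter σ N) (N + 1) (localGibbsProfile a u θ)) := by
  have hZ := canonicalPartition_localGibbs_pos' hσ2 N ha hθ hu ha0 hA hθ0
  have hp : ∀ k, localGibbsProfile a u θ (z k) ≠ 0 := fun k => (MacroClosureLine.StubLedger.localGibbsProfile_pos ha0 hθ0 _).ne'
  simp only [tensorPow]
  rw [Real.log_mul (inv_ne_zero hZ.ne') (Finset.prod_ne_zero_iff.2 fun k _ => hp k), Real.log_inv,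
    Real.log_prod fun k _ => hp k, MacroClosureLine.StubLedger.logPair_eq_sum, ← mul_assoc, mul_inv_cancel₀ (by positivity), one_mul]
  ring

/-- The empirical log-profile pairing is measurable (measurable profiles). [folklore] -/
theorem measurable_logPair' {N : ℕ} {a θ : T3 → ℝ} {u : T3 → V3}
    (ha : Measurable a) (hθ : Measurable θ) (hu : Measurable u) :
    Measurable fun z : Config (N + 1) (Fin 3) T3 =>
      (∫ y, Real.log (localGibbsProfile a u θ y) ∂(empiricalMeasure z)) := by
  simp_rw [MacroClosureLine.StubLedger.logPair_eq_sum]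
  refine measurable_const.mul (Finset.measurable_sum _ fun k _ => ?_)
  exact Real.measurable_log.comp ((measurable_localGibbsProfile' ha hθ hu).comp (measurable_pi_apply k))

end Summit.AtomisticToContinuum.HydrodynamicLimit.Theorems.BlockGibbsLine

end
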